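import Mathlib.Topology.Algebra.ClopenNhdofOne
import Mathlib.RingTheory.Algebraic.Cardinality
import Literature.NumberTheory.GaloisRepresentations.AbsGaloisGroup
import HarnessLib

/-!
# Cofinal sequences of open normal subgroups of `Γ_F`

Support for the construction of universal deformation rings as sequential limits
(`Literature.NumberTheory.GaloisRepresentations.DeformationProfiniteLevel`, Mazur §20 Prop. 2 made
explicit): Mazur's representability argument runs over the filtered system of open normal
subgroups of the profinite group `Π`; to realise the limit as an `ℕ`-indexed limit we need a
*cofinal decreasing sequence* of open normal subgroups.  This exists as soon as `Π` is compact with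
countably many open subgroups (`exists_antitone_openNormal_seq`), and `Γ_F = Gal(F̄/F)` for a
number field `F` has countably many open subgroups (`countable_setOf_isOpen_subgroup`: `F̄` is
countable and every open subgroup contains some `Gal(F̄/F(S))`, `S ⊆ F̄` finite, above which there
are only finitely many subgroups).  Main result:
`absoluteGaloisGroup_exists_antitone_openNormal_seq`.

References: B. Mazur, *An introduction to the deformation theory of Galois representations*, in
Cornell–Silverman–Stevens (1997), §20; J. Neukirch, *Algebraic Number Theory*, Ch. IV §1.
-/

noncomputable section

open Field

namespace Literature.NumberTheory.GaloisRepresentations.Deformation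

/-! ### Compact groups with countably many open subgroups -/

section General

variable {G : Type*} [Group G] [TopologicalSpace G] [IsTopologicalGroup G] [CompactSpace G]

/-- The normal core of an open subgroup of a compact group is open. [folklore] -/
theorem isOpen_normalCore_of_isOpen (V : Subgroup G) (hV : IsOpen (V : Set G)) :
    IsOpen (V.normalCore : Set G) := by
  haveI : Finite (G ⧸ V) := Subgroup.quotient_finite_of_isOpen V hV
  haveI : V.FiniteIndex := Subgroup.finiteIndex_of_finite_quotient
  exact Subgroup.isOpen_of_isClosed_of_finiteIndex _
    (Subgroup.normalCore_isClosed V (OpenSubgroup.isClosed ⟨V, hV⟩))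

/-- **A compact group with countably many open subgroups has a cofinal decreasing sequence of open
normal subgroups** (inside any given open normal subgroup). [folklore] -/
theorem exists_antitone_openNormal_seq (hc : {V : Subgroup G | IsOpen (V : Set G)}.Countable)
    (V₀ : Subgroup G) [V₀.Normal] (hV₀ : IsOpen (V₀ : Set G)) :
    ∃ U : ℕ → Subgroup G, (∀ N, (U N).Normal) ∧ (∀ N, IsOpen (U N : Set G)) ∧
      (∀ N, U (N + 1) ≤ U N) ∧ (∀ N, U N ≤ V₀) ∧
      ∀ V : Subgroup G, IsOpen (V : Set G) → ∃ N, U N ≤ V := by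
  obtain ⟨e, he⟩ := hc.exists_eq_range ⟨⊤, isOpen_univ⟩
  have heo : ∀ i, IsOpen (e i : Set G) := fun i => by
    have : e i ∈ {V : Subgroup G | IsOpen (V : Set G)} := he ▸ ⟨i, rfl⟩
    exact this
  let U : ℕ → Subgroup G := fun N =>
    Nat.rec ((e 0).normalCore ⊓ V₀) (fun i Ui => Ui ⊓ (e (i + 1)).normalCore) N
  have hU0 : U 0 = (e 0).normalCore ⊓ V₀ := rfl
  have hUs : ∀ N, U (N + 1) = U N ⊓ (e (N + 1)).normalCore := fun N => rfl
  have hnormal : ∀ N, (U N).Normal := by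
    intro N
    induction N with
    | zero => rw [hU0]; exact Subgroup.normal_inf_normal _ _
    | succ N ih => rw [hUs]; exact @Subgroup.normal_inf_normal _ _ _ _ ih (Subgroup.normalCore_normal _)
  have hopen : ∀ N, IsOpen (SetLike.coe (U N)) := by
    intro N
    induction N with
    | zero =>
      rw [hU0, Subgroup.coe_inf]
      exact (isOpen_normalCore_of_isOpen _ (heo 0)).inter hV₀
    | succ N ih =>
      rw [hUs, Subgroup.coe_inf]
      exact ih.inter (isOpen_normalCore_of_isOpen _ (heo _))
  have hle : ∀ N, U N ≤ (e N).normalCore := by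
    intro N
    cases N with
    | zero => rw [hU0]; exact inf_le_left
    | succ N => rw [hUs]; exact inf_le_right
  refine ⟨U, hnormal, hopen, fun N => by rw [hUs]; exact inf_le_left, fun N => ?_, fun V hV => ?_⟩
  · induction N with
    | zero => rw [hU0]; exact inf_le_right
    | succ N ih => rw [hUs]; exact le_trans inf_le_left ih
  · have : V ∈ Set.range e := he ▸ (hV : V ∈ {V : Subgroup G | IsOpen (V : Set G)})
    obtain ⟨i, rfl⟩ := this
    exact ⟨i, le_trans (hle i) (Subgroup.normalCore_le _)⟩

end General

/-! ### The absolute Galois group of a number field has countably many open subgroups -/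

section AbsoluteGalois

variable (F : Type*) [Field F] [NumberField F]

/-- A number field is countable. [folklore] -/
theorem countable_numberField : Countable F := by
  let b := Module.finBasis ℚ F
  exact Function.Surjective.countable b.equivFun.symm.surjective

/-- The algebraic closure of a number field is countable. [folklore] -/
theorem countable_algebraicClosure : Countable (AlgebraicClosure F) := by
  haveI := countable_numberField F
  rw [← Cardinal.mk_le_aleph0_iff]
  refine le_trans (Algebra.IsAlgebraic.cardinalMk_le_max F (AlgebraicClosure F)) ?_
  exact max_le (Cardinal.mk_le_aleph0) le_rfl

/-- The subgroups containing an open subgroup of `Γ_F` are finite in number. [folklore] -/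
theorem finite_setOf_le (H : Subgroup (absoluteGaloisGroup F)) (hH : IsOpen (H : Set (absoluteGaloisGroup F))) :
    {V : Subgroup (absoluteGaloisGroup F) | H ≤ V}.Finite := by
  haveI : Finite (absoluteGaloisGroup F ⧸ H) := Subgroup.quotient_finite_of_isOpen H hH
  refine Set.Finite.of_finite_image (f := fun V : Subgroup (absoluteGaloisGroup F) =>
    ((QuotientGroup.mk : absoluteGaloisGroup F → absoluteGaloisGroup F ⧸ H) '' (V : Set _)))
    (Set.toFinite _) ?_
  intro V₁ hV₁ V₂ hV₂ h
  simp only at h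
  have key : ∀ {W₁ W₂ : Subgroup (absoluteGaloisGroup F)}, H ≤ W₂ →
      (QuotientGroup.mk '' (W₁ : Set (absoluteGaloisGroup F)) : Set (absoluteGaloisGroup F ⧸ H)) =
        QuotientGroup.mk '' (W₂ : Set _) → W₁ ≤ W₂ := by
    intro W₁ W₂ hW₂ himg x hx
    have : (QuotientGroup.mk x : absoluteGaloisGroup F ⧸ H) ∈ QuotientGroup.mk '' (W₂ : Set _) :=
      himg ▸ ⟨x, hx, rfl⟩
    obtain ⟨y, hy, hyx⟩ := this
    have hxy : x⁻¹ * y ∈ H := QuotientGroup.eq.1 hyx.symm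
    have : x = y * (x⁻¹ * y)⁻¹ := by group
    rw [this]
    exact W₂.mul_mem hy (W₂.inv_mem (hW₂ hxy))
  exact le_antisymm (key hV₂ h) (key hV₁ h.symm)

/-- **`Γ_F` has countably many open subgroups** (`F̄` is countable, and an open subgroup contains
`Gal(F̄/F(S))` for a finite `S ⊆ F̄`, above which there are finitely many subgroups).
[folklore] -/
theorem countable_setOf_isOpen_subgroup :
    {V : Subgroup (absoluteGaloisGroup F) | IsOpen (V : Set (absoluteGaloisGroup F))}.Countable := by
  haveI := countable_algebraicClosure F
  -- the countable family of subgroups `Gal(F̄/F(S))`, `S` finite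
  let HS : Set (AlgebraicClosure F) → Subgroup (absoluteGaloisGroup F) := fun S =>
    (IntermediateField.adjoin F S).fixingSubgroup
  have hcount : {S : Set (AlgebraicClosure F) | S.Finite}.Countable :=
    (Set.countable_setOf_finite_subset Set.countable_univ).mono fun S (hS : S.Finite) =>
      show S.Finite ∧ S ⊆ Set.univ from ⟨hS, Set.subset_univ _⟩
  refine (hcount.biUnion fun S (hS : S.Finite) => (finite_setOf_le F (HS S) ?_).countable).mono ?_
  · haveI : Finite S := hS.to_subtype
    haveI : FiniteDimensional F (IntermediateField.adjoin F S) :=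
      IntermediateField.finiteDimensional_adjoin fun x _ => Algebra.IsIntegral.isIntegral x
    exact IntermediateField.fixingSubgroup_isOpen _
  · intro V hV
    have hV' : IsOpen (V : Set (absoluteGaloisGroup F)) := hV
    have h1 : (V : Set (absoluteGaloisGroup F)) ∈ nhds (1 : absoluteGaloisGroup F) :=
      hV'.mem_nhds V.one_mem
    obtain ⟨E, hEfd, hEV⟩ := (krullTopology_mem_nhds_one_iff F (AlgebraicClosure F) _).1 h1
    let b := Module.finBasis F E
    refine Set.mem_biUnion (x := Set.range fun i => (b i : AlgebraicClosure F)) (Set.finite_range _) ?_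
    change HS _ ≤ V
    have hEle : E ≤ IntermediateField.adjoin F (Set.range fun i => (b i : AlgebraicClosure F)) := by
      intro x hx
      have hrepr := b.sum_repr ⟨x, hx⟩
      have hx' : (∑ i, b.repr ⟨x, hx⟩ i • (b i : AlgebraicClosure F)) = x := by
        have := congrArg E.val hrepr
        rw [map_sum] at this
        exact this
      have hmem : (∑ i, b.repr ⟨x, hx⟩ i • (b i : AlgebraicClosure F)) ∈
          IntermediateField.adjoin F (Set.range fun i => (b i : AlgebraicClosure F)) :=
        IntermediateField.sum_mem _ fun i _ => IntermediateField.smul_mem _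
          (IntermediateField.subset_adjoin F (Set.range fun i => (b i : AlgebraicClosure F)) ⟨i, rfl⟩)
      rwa [hx'] at hmem
    intro σ hσ
    apply hEV
    rw [SetLike.mem_coe, IntermediateField.mem_fixingSubgroup_iff]
    intro x hx
    exact (IntermediateField.mem_fixingSubgroup_iff _ _).1 hσ x (hEle hx)

/-- **A cofinal decreasing sequence of open normal subgroups of `Γ_F`**, inside a given open normal
subgroup `V₀`. [folklore] -/
theorem absoluteGaloisGroup_exists_antitone_openNormal_seq (V₀ : Subgroup (absoluteGaloisGroup F))
    [V₀.Normal] (hV₀ : IsOpen (V₀ : Set (absoluteGaloisGroup F))) :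
    ∃ U : ℕ → Subgroup (absoluteGaloisGroup F), (∀ N, (U N).Normal) ∧
      (∀ N, IsOpen (U N : Set (absoluteGaloisGroup F))) ∧ (∀ N, U (N + 1) ≤ U N) ∧ (∀ N, U N ≤ V₀) ∧
      ∀ V : Subgroup (absoluteGaloisGroup F), IsOpen (V : Set (absoluteGaloisGroup F)) → ∃ N, U N ≤ V :=
  exists_antitone_openNormal_seq (countable_setOf_isOpen_subgroup F) V₀ hV₀

end AbsoluteGalois

end Literature.NumberTheory.GaloisRepresentations.Deformation
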